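import Mathlib.Data.Real.Basic
import Mathlib.Tactic.Linarith
import Mathlib.Tactic.Positivity
import Mathlib.Tactic.FieldSimp
import Mathlib.Tactic.Ring
import HarnessLib

/-!
# QUANT lane R8, T-DEC, binder (II) `ConvClosedTResidue`: the TWO-LOW GREEDY — flows for two low atoms and three mids + a giant pool
# from the four "breakpoint" inequalities (one per absorber at which the first low's greedy stops)

builds on p205010 (kernel theorem, internal audit signed; external expert review pending)

Support file (`--supports stmt-CriticalPhenomena-4575`), QUANT lane seat prim-quant-census-1 (gen 22), rung R8 of
`run/shared/lean/prim/quant/LADDER.md`.  Memo `run/shared/lean/prim/quant/prim-quant-census-1/LSCORE-G22.md` §2.  Pure real arithmetic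
(no laws): theorems only, standard axioms, no sorries.

THE STATEMENT.  Two lows with masses `P₁, P₂ ≥ 0`; three mid absorbers `A, B, C` with capacities `c_A, c_B, c_C ≥ 0` and a giant pool of
capacity `c_G ≥ 0` charged at the common rate `u > 0`; low `i` may use mid `k` ("available", `av_ik`) at the usage rate `U_ik > 0`, in which
case `a_ik = c_k / U_ik` is the capacity of `k` in units of low-`i` mass (`a_ik = 0` when unavailable), and `κ_k = U_2k / U_1k` is the exchange
ratio at `k` (`0` when `k` is unavailable to low 1).  THE GREEDY: low 2 fills `A`, then `B`, then `C`, then the pool; low 1 takes what is left.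
It succeeds as soon as, for the absorber `k` at which low 2 stops, ONE inequality holds — `P₁ ≤ (cumulative a_2 up to k − P₂)·κ_k + Σ_{h after k} a_1h
(+ pool)` — these are the vertices of the LP dual ("breakpoints" of the memo); the theorem returns the eight flows with their sign, availability,
row-sum and capacity properties, ready for `LawDec.lsLaw_decAtT_of_flow` (`…QuantLSCoreFlow`).  In the light-slice law of the residue the
mids are `m+l, m+l′, p+h` in this order (the Monge order of the exchange ratios is universal there, memo §2), and the four inequalities are
the cells of `…QuantLSCoreMMGCells`.

* `LawDec.split4_le` — proportional split of a mass `P ≤ v_A + v_B + v_C + v_G` into parts below the `v`'s.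
* `LawDec.twoLow_greedy_flows` — the statement above.

[this work].  LP duality for transportation problems with gains is classical; nothing here is cited as a published result.  The gluing
rows served [cite: KozmaNitzan2024, Conjecture 3 (p. 15)]; product measure [cite: Grimmett1999, §1.3 p. 10].
-/

namespace Summit.CriticalPhenomena.PercolationContinuityZ3.Theorems

namespace Quant

namespace LawDec

/-- **proportional split**: a mass `0 ≤ P ≤ v_A + v_B + v_C + v_G` (`v ≥ 0`) splits into four parts `0 ≤ f ≤ v` with sum `P`. [this work] -/
theorem split4_le (P vA vB vC vG : ℝ) (hP : 0 ≤ P) (hA : 0 ≤ vA) (hB : 0 ≤ vB) (hC : 0 ≤ vC) (hG : 0 ≤ vG)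
    (hS : P ≤ vA + vB + vC + vG) :
    ∃ fA fB fC fG : ℝ, 0 ≤ fA ∧ 0 ≤ fB ∧ 0 ≤ fC ∧ 0 ≤ fG ∧ fA ≤ vA ∧ fB ≤ vB ∧ fC ≤ vC ∧ fG ≤ vG ∧ fA + fB + fC + fG = P := by
  set S := vA + vB + vC + vG with hSdef
  rcases (show 0 ≤ S by rw [hSdef]; linarith).eq_or_lt with hS0 | hSpos
  · refine ⟨0, 0, 0, 0, le_rfl, le_rfl, le_rfl, le_rfl, hA, hB, hC, hG, ?_⟩
    linarith
  · have hθ0 : 0 ≤ P / S := div_nonneg hP hSpos.le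
    have hθ1 : P / S ≤ 1 := (div_le_one hSpos).2 hS
    refine ⟨P / S * vA, P / S * vB, P / S * vC, P / S * vG, by positivity, by positivity, by positivity, by positivity, ?_, ?_, ?_, ?_, ?_⟩
    · nlinarith
    · nlinarith
    · nlinarith
    · nlinarith
    · have : P / S * vA + P / S * vB + P / S * vC + P / S * vG = P / S * S := by rw [hSdef]; ring
      rw [this, div_mul_cancel₀ _ hSpos.ne']

/-- **THE TWO-LOW GREEDY.**  See the file header.  Inputs: `P₁, P₂ ≥ 0`; pool `c_G ≥ 0` at rate `u > 0`; mids `A, B, C` with capacities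
`c ≥ 0`, rates `U_ik`, capacities in low units `a_ik ≥ 0` (`av_ik → 0 < U_ik ∧ a_ik·U_ik = c_k`, `¬av_ik → a_ik = 0`; `a_1A` is not needed) and exchange ratios
`κ_k ≥ 0` (`av_1k → κ_k·U_1k = U_2k`, `¬av_1k → κ_k = 0`); the four breakpoint inequalities, each under the hypothesis that low 2 stops
at that absorber.  Output: flows `F_1k, F_2k ≥ 0` into the mids (positive only where available) and rests `R₁, R₂ ≥ 0` into the pool with
the row sums `P₁, P₂`, no mid overloaded (`U_1k F_1k + U_2k F_2k ≤ c_k`) and `u·(R₁ + R₂) ≤ c_G`. [this work] -/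
theorem twoLow_greedy_flows (P₁ P₂ u cG cA cB cC UA₁ UA₂ UB₁ UB₂ UC₁ UC₂ aA₂ aB₁ aB₂ aC₁ aC₂ κA κB κC : ℝ)
    (avA₁ avA₂ avB₁ avB₂ avC₁ avC₂ : Prop)
    (hP1 : 0 ≤ P₁) (hP2 : 0 ≤ P₂) (hu : 0 < u) (hcG : 0 ≤ cG) (hcA : 0 ≤ cA) (hcB : 0 ≤ cB) (hcC : 0 ≤ cC)
    (haA2 : 0 ≤ aA₂) (haB1 : 0 ≤ aB₁) (haB2 : 0 ≤ aB₂) (haC1 : 0 ≤ aC₁) (haC2 : 0 ≤ aC₂)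
    (hA2 : avA₂ → 0 < UA₂ ∧ aA₂ * UA₂ = cA) (hA2' : ¬ avA₂ → aA₂ = 0)
    (hB1 : avB₁ → 0 < UB₁ ∧ aB₁ * UB₁ = cB) (hB1' : ¬ avB₁ → aB₁ = 0)
    (hB2 : avB₂ → 0 < UB₂ ∧ aB₂ * UB₂ = cB) (hB2' : ¬ avB₂ → aB₂ = 0)
    (hC1 : avC₁ → 0 < UC₁ ∧ aC₁ * UC₁ = cC) (hC1' : ¬ avC₁ → aC₁ = 0)
    (hC2 : avC₂ → 0 < UC₂ ∧ aC₂ * UC₂ = cC) (hC2' : ¬ avC₂ → aC₂ = 0)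
    (hκA0 : 0 ≤ κA) (hκA : avA₁ → κA * UA₁ = UA₂) (hκA' : ¬ avA₁ → κA = 0)
    (hκB0 : 0 ≤ κB) (hκB : avB₁ → κB * UB₁ = UB₂) (hκB' : ¬ avB₁ → κB = 0)
    (hκC0 : 0 ≤ κC) (hκC : avC₁ → κC * UC₁ = UC₂) (hκC' : ¬ avC₁ → κC = 0)
    (hkA : avA₂ → P₂ ≤ aA₂ → P₁ ≤ (aA₂ - P₂) * κA + aB₁ + aC₁ + cG / u)
    (hkB : avB₂ → aA₂ ≤ P₂ → P₂ ≤ aA₂ + aB₂ → P₁ ≤ (aA₂ + aB₂ - P₂) * κB + aC₁ + cG / u)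
    (hkC : avC₂ → aA₂ + aB₂ ≤ P₂ → P₂ ≤ aA₂ + aB₂ + aC₂ → P₁ ≤ (aA₂ + aB₂ + aC₂ - P₂) * κC + cG / u)
    (hkG : aA₂ + aB₂ + aC₂ ≤ P₂ → P₁ + P₂ ≤ aA₂ + aB₂ + aC₂ + cG / u) :
    ∃ F₁A F₁B F₁C R₁ F₂A F₂B F₂C R₂ : ℝ,
      0 ≤ F₁A ∧ 0 ≤ F₁B ∧ 0 ≤ F₁C ∧ 0 ≤ R₁ ∧ 0 ≤ F₂A ∧ 0 ≤ F₂B ∧ 0 ≤ F₂C ∧ 0 ≤ R₂ ∧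
      (0 < F₁A → avA₁) ∧ (0 < F₁B → avB₁) ∧ (0 < F₁C → avC₁) ∧ (0 < F₂A → avA₂) ∧ (0 < F₂B → avB₂) ∧ (0 < F₂C → avC₂) ∧
      F₁A + F₁B + F₁C + R₁ = P₁ ∧ F₂A + F₂B + F₂C + R₂ = P₂ ∧
      UA₁ * F₁A + UA₂ * F₂A ≤ cA ∧ UB₁ * F₁B + UB₂ * F₂B ≤ cB ∧ UC₁ * F₁C + UC₂ * F₂C ≤ cC ∧ u * (R₁ + R₂) ≤ cG := by
  classical
  have hGu : 0 ≤ cG / u := div_nonneg hcG hu.le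
  -- positivity of a capacity forces availability
  have avB1_of : 0 < aB₁ → avB₁ := fun h => by by_contra hn; rw [hB1' hn] at h; exact lt_irrefl _ h
  have avC1_of : 0 < aC₁ → avC₁ := fun h => by by_contra hn; rw [hC1' hn] at h; exact lt_irrefl _ h
  have avA2_of : 0 < aA₂ → avA₂ := fun h => by by_contra hn; rw [hA2' hn] at h; exact lt_irrefl _ h
  have avB2_of : 0 < aB₂ → avB₂ := fun h => by by_contra hn; rw [hB2' hn] at h; exact lt_irrefl _ h
  have avC2_of : 0 < aC₂ → avC₂ := fun h => by by_contra hn; rw [hC2' hn] at h; exact lt_irrefl _ h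
  -- full use of a mid by low 2 alone / by low 1 alone never overloads it
  have fullA2 : UA₂ * aA₂ ≤ cA := by
    by_cases h : avA₂
    · rw [mul_comm, (hA2 h).2]
    · rw [hA2' h, mul_zero]; exact hcA
  have fullB2 : UB₂ * aB₂ ≤ cB := by
    by_cases h : avB₂
    · rw [mul_comm, (hB2 h).2]
    · rw [hB2' h, mul_zero]; exact hcB
  have fullC2 : UC₂ * aC₂ ≤ cC := by
    by_cases h : avC₂
    · rw [mul_comm, (hC2 h).2]
    · rw [hC2' h, mul_zero]; exact hcC
  have fullB1 : ∀ f, 0 ≤ f → f ≤ aB₁ → UB₁ * f ≤ cB := by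
    intro f hf0 hf
    by_cases h : avB₁
    · calc UB₁ * f ≤ UB₁ * aB₁ := mul_le_mul_of_nonneg_left hf (hB1 h).1.le
        _ = cB := by rw [mul_comm, (hB1 h).2]
    · have : f = 0 := le_antisymm (by rw [hB1' h] at hf; exact hf) hf0
      rw [this, mul_zero]; exact hcB
  have fullC1 : ∀ f, 0 ≤ f → f ≤ aC₁ → UC₁ * f ≤ cC := by
    intro f hf0 hf
    by_cases h : avC₁
    · calc UC₁ * f ≤ UC₁ * aC₁ := mul_le_mul_of_nonneg_left hf (hC1 h).1.le
        _ = cC := by rw [mul_comm, (hC1 h).2]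
    · have : f = 0 := le_antisymm (by rw [hC1' h] at hf; exact hf) hf0
      rw [this, mul_zero]; exact hcC
  -- the shared mid: low 2 ships `g ≤ a₂`, low 1 ships `f ≤ (a₂ − g)·κ`
  have shared : ∀ (U₁ U₂ a₂ κ c f g : ℝ) (av₁ av₂ : Prop), (av₂ → 0 < U₂ ∧ a₂ * U₂ = c) → (¬ av₂ → a₂ = 0) → 0 ≤ c →
      0 ≤ κ → (av₁ → κ * U₁ = U₂) → (¬ av₁ → κ = 0) → 0 ≤ f → f ≤ (a₂ - g) * κ → 0 ≤ g → g ≤ a₂ →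
      U₁ * f + U₂ * g ≤ c := by
    intro U₁ U₂ a₂ κ c f g av₁ av₂ h2 h2' hc hκ0 hκ hκ' hf0 hf hg0 hg
    by_cases h : av₂
    · obtain ⟨hU2, hc2⟩ := h2 h
      by_cases h1 : av₁
      · have e := hκ h1
        -- `U₁ f ≤ U₁ (a₂ − g) κ = (a₂ − g) U₂`
        have hU1 : 0 < U₁ := by
          by_contra hn
          have : κ * U₁ ≤ 0 := by
            rcases le_or_gt 0 U₁ with h0 | h0
            · have : U₁ = 0 := le_antisymm (not_lt.1 hn) h0
              rw [this, mul_zero]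
            · exact mul_nonpos_iff.2 (Or.inl ⟨hκ0, h0.le⟩)
          linarith
        calc U₁ * f + U₂ * g ≤ U₁ * ((a₂ - g) * κ) + U₂ * g := by nlinarith
          _ = (a₂ - g) * (κ * U₁) + U₂ * g := by ring
          _ = a₂ * U₂ := by rw [e]; ring
          _ = c := hc2
      · have hκz := hκ' h1
        have hfz : f = 0 := le_antisymm (by rw [hκz, mul_zero] at hf; exact hf) hf0
        rw [hfz, mul_zero, zero_add]
        calc U₂ * g ≤ U₂ * a₂ := mul_le_mul_of_nonneg_left hg hU2.le
          _ = c := by rw [mul_comm, hc2]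
    · have ha := h2' h
      have hgz : g = 0 := le_antisymm (by rw [ha] at hg; exact hg) hg0
      have hfz : f = 0 := le_antisymm (by rw [ha, hgz, sub_zero, zero_mul] at hf; exact hf) hf0
      rw [hfz, hgz, mul_zero, mul_zero, add_zero]; exact hc
  -- CASE A: low 2 fits into `A`
  by_cases cA2 : avA₂ ∧ P₂ ≤ aA₂
  · obtain ⟨hav, hle⟩ := cA2
    have hv : 0 ≤ (aA₂ - P₂) * κA := mul_nonneg (by linarith) hκA0
    obtain ⟨fA, fB, fC, fG, fA0, fB0, fC0, fG0, fAv, fBv, fCv, fGv, fsum⟩ :=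
      split4_le P₁ _ _ _ _ hP1 hv haB1 haC1 hGu (hkA hav hle)
    refine ⟨fA, fB, fC, fG, P₂, 0, 0, 0, fA0, fB0, fC0, fG0, hP2, le_rfl, le_rfl, le_rfl,
      ?_, fun h => avB1_of (lt_of_lt_of_le h fBv), fun h => avC1_of (lt_of_lt_of_le h fCv), fun _ => hav,
      fun h => absurd h (lt_irrefl 0), fun h => absurd h (lt_irrefl 0), fsum, by ring, ?_, ?_, ?_, ?_⟩
    · intro h
      by_contra hn
      rw [hκA' hn, mul_zero] at fAv
      linarith
    · exact shared UA₁ UA₂ aA₂ κA cA fA P₂ avA₁ avA₂ hA2 hA2' hcA hκA0 hκA hκA' fA0 fAv hP2 hle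
    · rw [mul_zero, add_zero]; exact fullB1 fB fB0 fBv
    · rw [mul_zero, add_zero]; exact fullC1 fC fC0 fCv
    · rw [add_zero]
      calc u * fG ≤ u * (cG / u) := mul_le_mul_of_nonneg_left fGv hu.le
        _ = cG := mul_div_cancel₀ _ hu.ne'
  · -- from here on low 2 uses `A` fully
    have hgeA : aA₂ ≤ P₂ := by
      by_cases h : avA₂
      · by_contra hn; exact cA2 ⟨h, (not_le.1 hn).le⟩
      · rw [hA2' h]; exact hP2
    -- CASE B
    by_cases cB2 : avB₂ ∧ P₂ ≤ aA₂ + aB₂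
    · obtain ⟨hav, hle⟩ := cB2
      have hv : 0 ≤ (aA₂ + aB₂ - P₂) * κB := mul_nonneg (by linarith) hκB0
      obtain ⟨fB, fC, fG, fZ, fB0, fC0, fG0, fZ0, fBv, fCv, fGv, fZv, fsum⟩ :=
        split4_le P₁ _ _ _ 0 hP1 hv haC1 hGu le_rfl (by linarith [hkB hav hgeA hle])
      have fZz : fZ = 0 := le_antisymm fZv fZ0
      refine ⟨0, fB, fC, fG, aA₂, P₂ - aA₂, 0, 0, le_rfl, fB0, fC0, fG0, haA2, by linarith, le_rfl, le_rfl,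
        fun h => absurd h (lt_irrefl 0), ?_, fun h => avC1_of (lt_of_lt_of_le h fCv), avA2_of, fun _ => hav,
        fun h => absurd h (lt_irrefl 0), by linarith, by ring, ?_, ?_, ?_, ?_⟩
      · intro h
        by_contra hn
        rw [hκB' hn, mul_zero] at fBv
        linarith
      · rw [mul_zero, zero_add]; exact fullA2
      · exact shared UB₁ UB₂ aB₂ κB cB fB (P₂ - aA₂) avB₁ avB₂ hB2 hB2' hcB hκB0 hκB hκB' fB0 (by linarith) (by linarith)
          (by linarith)
      · rw [mul_zero, add_zero]; exact fullC1 fC fC0 fCv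
      · rw [add_zero]
        calc u * fG ≤ u * (cG / u) := mul_le_mul_of_nonneg_left fGv hu.le
          _ = cG := mul_div_cancel₀ _ hu.ne'
    · have hgeB : aA₂ + aB₂ ≤ P₂ := by
        by_cases h : avB₂
        · by_contra hn; exact cB2 ⟨h, (not_le.1 hn).le⟩
        · rw [hB2' h]; linarith
      -- CASE C
      by_cases cC2 : avC₂ ∧ P₂ ≤ aA₂ + aB₂ + aC₂
      · obtain ⟨hav, hle⟩ := cC2
        have hv : 0 ≤ (aA₂ + aB₂ + aC₂ - P₂) * κC := mul_nonneg (by linarith) hκC0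
        obtain ⟨fC, fG, fY, fZ, fC0, fG0, fY0, fZ0, fCv, fGv, fYv, fZv, fsum⟩ :=
          split4_le P₁ _ _ 0 0 hP1 hv hGu le_rfl le_rfl (by linarith [hkC hav hgeB hle])
        have fYz : fY = 0 := le_antisymm fYv fY0
        have fZz : fZ = 0 := le_antisymm fZv fZ0
        refine ⟨0, 0, fC, fG, aA₂, aB₂, P₂ - aA₂ - aB₂, 0, le_rfl, le_rfl, fC0, fG0, haA2, haB2, by linarith, le_rfl,
          fun h => absurd h (lt_irrefl 0), fun h => absurd h (lt_irrefl 0), ?_, avA2_of, avB2_of, fun _ => hav,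
          by linarith, by ring, ?_, ?_, ?_, ?_⟩
        · intro h
          by_contra hn
          rw [hκC' hn, mul_zero] at fCv
          linarith
        · rw [mul_zero, zero_add]; exact fullA2
        · rw [mul_zero, zero_add]; exact fullB2
        · exact shared UC₁ UC₂ aC₂ κC cC fC (P₂ - aA₂ - aB₂) avC₁ avC₂ hC2 hC2' hcC hκC0 hκC hκC' fC0 (by linarith)
            (by linarith) (by linarith)
        · rw [add_zero]
          calc u * fG ≤ u * (cG / u) := mul_le_mul_of_nonneg_left fGv hu.le
            _ = cG := mul_div_cancel₀ _ hu.ne'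
      · have hgeC : aA₂ + aB₂ + aC₂ ≤ P₂ := by
          by_cases h : avC₂
          · by_contra hn; exact cC2 ⟨h, (not_le.1 hn).le⟩
          · rw [hC2' h]; linarith
        -- CASE G: low 2 overflows into the pool, low 1 rides the pool only
        have hk := hkG hgeC
        refine ⟨0, 0, 0, P₁, aA₂, aB₂, aC₂, P₂ - aA₂ - aB₂ - aC₂, le_rfl, le_rfl, le_rfl, hP1, haA2, haB2, haC2, by linarith,
          fun h => absurd h (lt_irrefl 0), fun h => absurd h (lt_irrefl 0), fun h => absurd h (lt_irrefl 0),
          avA2_of, avB2_of, avC2_of, by ring, by ring, ?_, ?_, ?_, ?_⟩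
        · rw [mul_zero, zero_add]; exact fullA2
        · rw [mul_zero, zero_add]; exact fullB2
        · rw [mul_zero, zero_add]; exact fullC2
        · have : P₁ + (P₂ - aA₂ - aB₂ - aC₂) ≤ cG / u := by linarith
          calc u * (P₁ + (P₂ - aA₂ - aB₂ - aC₂)) ≤ u * (cG / u) := mul_le_mul_of_nonneg_left this hu.le
            _ = cG := mul_div_cancel₀ _ hu.ne'

end LawDec

end Quant

end Summit.CriticalPhenomena.PercolationContinuityZ3.Theorems
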